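import Summits.ResolutionOfSingularities.ResolutionOfSingularities.Theses.UniversalCells
import Summits.ResolutionOfSingularities.ResolutionOfSingularities.Theorems.WeightedInvariantDescentReducedToIntegral
import Summits.ResolutionOfSingularities.ResolutionOfSingularities.Theorems.UniversalCellsPrimeFieldToPerfectStubTower
import Summits.ResolutionOfSingularities.ResolutionOfSingularities.Theorems.UniversalCellsPrimeFieldToPerfectStubSeparableDescent
import Summits.ResolutionOfSingularities.ResolutionOfSingularities.Theorems.UniversalCellsPrimeFieldToPerfectStubClimbAlgebraic
import Summits.ResolutionOfSingularities.ResolutionOfSingularities.Theorems.UniversalCellsPrimeFieldToPerfectClimbOfRatFuncPerf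
import HarnessLib

/-!
# Crux `PrimeFieldToPerfect` (stmt-ResolutionOfSingularities-15233) from its kernel `ClimbRatFuncPerf` alone

Route `ResolutionOfSingularities/UniversalCells`, crux `PrimeFieldToPerfect`, line `birth` (lead c2
prover-line-stmt-ResolutionOfSingularities-15233-c2-0, RESHAPE 4 of lead c1). Every registered stub of the
skeleton `Cruxes/PrimeFieldToPerfect/Lines/birth.lean` except ONE is a theorem of the tree:

* `PrimeFieldToPerfect.stub_tower` (Theorems/UniversalCellsPrimeFieldToPerfectStubTower.lean, p152147):
  prime field + the one-transcendental climb ⇒ perfect closures of finitely generated fields;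
* `PrimeFieldToPerfect.stub_separableDescent` (…StubSeparableDescent.lean, p149298): perfect closures of
  finitely generated fields ⇒ all perfect fields;
* `PrimeFieldToPerfect.stub_climbAlgebraic` (…StubClimbAlgebraic.lean, p154863): resolution passes along
  ALGEBRAIC extensions of a perfect field;
* `PrimeFieldToPerfect.climbTranscendental_of_climbRatFuncPerf` (…ClimbOfRatFuncPerf.lean, p156288): the
  transcendental climb follows from its live case over `(RatFunc M)^{perf}`;

and reduced ⇒ integral over a fixed field is `Theorems.descentReducedToIntegral_proof` (stmt-0551). This
file records, importably and sorry-free, what they buy: **the crux follows from the kernel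
`ClimbRatFuncPerf` alone** (`primeFieldToPerfect_of_climbRatFuncPerf`), the kernel being VERBATIM the
registered signature of the one open stub `stub_climbRatFuncPerf` (universally closed over its parameters):
for every prime `p` and every PERFECT field `M` of characteristic `p` over which all integral separated
finite-type schemes have resolutions, all integral separated finite-type schemes over every perfect field
`L` purely inseparable over the rational function field `RatFunc M` (i.e. `L ≅ M(t)^{perf}`) have
resolutions. When that statement is proved (as an item or a stub), `PrimeFieldToPerfect` closes by this
theorem with no further work; conversely `climbRatFuncPerf_of_resolutionOfSingularities` records that the
kernel is implied by the summit (it asks for nothing the summit does not give). No new mathematics is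
claimed here.

Why the kernel is open (pointers, not used below): at every finite level `M(t^{1/p^m}) ≅ RatFunc M` the
hypothesis supplies only REGULAR models, and regular ⇏ smooth over an imperfect field
(`Literature.Barriers.ResolutionOfSingularities.RegularNotGeometricallyRegular`); "resolve, adjoin a
`p`-th root of `t`, re-resolve" has no termination argument in print beyond curves (Tate's genus drop) —
dimension ≤ 3 of `X` is unconditional (Cossart–Piltant) — and Hu (arXiv:2507.21400, p. 9) defers exactly
this transfer to an unpublished sequel. See the crux workfiles `Cruxes/PrimeFieldToPerfect/{KERNEL.md,
KERNEL-c1.md, STRATEGY-CENSUS.md, Disproof.lean}`.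
-/

noncomputable section

set_option linter.dupNamespace false -- mandated namespace of this single-conjunct summit

open CategoryTheory CategoryTheory.Limits AlgebraicGeometry TopologicalSpace
open Literature.AlgebraicGeometry.Resolution

namespace Summit.ResolutionOfSingularities.ResolutionOfSingularities.Theorems.PrimeFieldToPerfect

/-- **`PrimeFieldToPerfect` from the kernel `ClimbRatFuncPerf`.** If, for every prime `p` and every
perfect field `M` of characteristic `p` with resolution of all integral separated finite-type
`M`-schemes, resolution holds for all integral separated finite-type schemes over every perfect field
`L` purely inseparable over `RatFunc M` (the registered stub `stub_climbRatFuncPerf` of the crux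
skeleton, RESHAPE 4, verbatim as hypothesis) — then `UniversalCells.PrimeFieldToPerfect` holds. Chain, all
by tree names: kernel ⇒ transcendental climb (`climbTranscendental_of_climbRatFuncPerf`) ⇒ with the
algebraic case (`stub_climbAlgebraic`, excluded middle on `Transcendental M t`) the full one-transcendental
climb ⇒ perfect closures of finitely generated fields (`stub_tower`, from the crux hypothesis over
`ZMod p`) ⇒ all perfect fields (`stub_separableDescent`) ⇒ reduced schemes
(`descentReducedToIntegral_proof`). [folklore] -/
theorem primeFieldToPerfect_of_climbRatFuncPerf
    (hR : ∀ p : ℕ, p.Prime → ∀ (M : Type) [Field M] [CharP M p] [PerfectField M],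
      (∀ (X : Scheme.{0}) (f : X ⟶ Spec (.of M)), IsSeparated f → LocallyOfFiniteType f →
        QuasiCompact f → IsIntegral X → Scheme.HasResolution X) →
      ∀ (L : Type) [Field L] [PerfectField L] [Algebra (RatFunc M) L]
        [IsPurelyInseparable (RatFunc M) L]
        (X : Scheme.{0}) (f : X ⟶ Spec (.of L)), IsSeparated f → LocallyOfFiniteType f →
          QuasiCompact f → IsIntegral X → Scheme.HasResolution X) :
    Summit.ResolutionOfSingularities.ResolutionOfSingularities.Theses.UniversalCells.PrimeFieldToPerfect := by
  intro p hp h₀ k _ _ _ X f hs hl hq hr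
  -- the one-transcendental climb over a perfect constant field, by cases on `t`
  have hClimb : ∀ (M : Type) [Field M] [CharP M p] [PerfectField M],
      (∀ (X : Scheme.{0}) (f : X ⟶ Spec (.of M)), IsSeparated f → LocallyOfFiniteType f →
        QuasiCompact f → IsIntegral X → Scheme.HasResolution X) →
      ∀ (L : Type) [Field L] [CharP L p] [PerfectField L] [Algebra M L] (t : L),
        Algebra.IsAlgebraic (IntermediateField.adjoin M ({t} : Set L)) L →
        ∀ (X : Scheme.{0}) (f : X ⟶ Spec (.of L)), IsSeparated f → LocallyOfFiniteType f →
          QuasiCompact f → IsIntegral X → Scheme.HasResolution X := by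
    intro M _ _ _ hM L _ _ _ _ t ht Y g hs' hl' hq' hY
    by_cases htr : Transcendental M t
    · exact climbTranscendental_of_climbRatFuncPerf hR p hp M hM L t htr ht Y g hs' hl' hq' hY
    · -- `t` algebraic: `M⟮t⟯/M` is finite, `L/M⟮t⟯` algebraic, so `L/M` is algebraic
      have halg : IsAlgebraic M t := Classical.not_not.mp htr
      haveI : FiniteDimensional M (IntermediateField.adjoin M ({t} : Set L)) :=
        IntermediateField.adjoin.finiteDimensional halg.isIntegral
      haveI : Algebra.IsAlgebraic M (IntermediateField.adjoin M ({t} : Set L)) :=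
        Algebra.IsAlgebraic.of_finite M _
      haveI : Algebra.IsAlgebraic (IntermediateField.adjoin M ({t} : Set L)) L := ht
      haveI : Algebra.IsAlgebraic M L :=
        Algebra.IsAlgebraic.trans M (IntermediateField.adjoin M ({t} : Set L)) L
      exact stub_climbAlgebraic M hM L Y g hs' hl' hq' hY
  -- ⇒ perfect closures of finitely generated fields (stub_tower, from the hypothesis over `ZMod p`)
  have hPC : ∀ (K : Type) [Field K] [CharP K p], (∃ s : Finset K, Subfield.closure (s : Set K) = ⊤) →
      ∀ (L : Type) [Field L] [PerfectField L] [Algebra K L] [IsPurelyInseparable K L]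
        (X : Scheme.{0}) (f : X ⟶ Spec (.of L)), IsSeparated f → LocallyOfFiniteType f →
          QuasiCompact f → IsIntegral X → Scheme.HasResolution X :=
    fun K _ _ hK L _ _ _ _ Y g hs' hl' hq' hY =>
      stub_tower p hp h₀ (fun M _ _ _ hM L _ _ _ _ t ht => hClimb M hM L t ht) K hK L Y g hs' hl' hq' hY
  -- ⇒ all perfect fields, integral schemes (stub_separableDescent)
  have hInt : ∀ (Y : Scheme.{0}) (g : Y ⟶ Spec (.of k)), IsSeparated g → LocallyOfFiniteType g →
      QuasiCompact g → IsIntegral Y → Scheme.HasResolution Y :=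
    fun Y g hs' hl' hq' hint => stub_separableDescent p hp hPC k Y g hs' hl' hq' hint
  -- ⇒ reduced schemes over the fixed perfect field k (stmt-0551)
  exact Summit.ResolutionOfSingularities.ResolutionOfSingularities.Theorems.descentReducedToIntegral_proof
    k hInt X f hs hl hq hr

/-- **The kernel asks for nothing the summit does not give** (sanity, the cut loses nothing): resolution
of singularities in every positive characteristic implies the kernel `ClimbRatFuncPerf`, because a perfect
field purely inseparable over `RatFunc M`, `M` of prime characteristic `p`, is a field of characteristic
`p`, and an integral scheme is reduced. So the kernel sits between the crux (which it implies,
`primeFieldToPerfect_of_climbRatFuncPerf`) and the summit (which implies it); in particular it is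
irrefutable short of `¬ ResolutionOfSingularities`. [folklore] -/
theorem climbRatFuncPerf_of_resolutionOfSingularities (h : _root_.ResolutionOfSingularities) :
    ∀ p : ℕ, p.Prime → ∀ (M : Type) [Field M] [CharP M p] [PerfectField M],
      (∀ (X : Scheme.{0}) (f : X ⟶ Spec (.of M)), IsSeparated f → LocallyOfFiniteType f →
        QuasiCompact f → IsIntegral X → Scheme.HasResolution X) →
      ∀ (L : Type) [Field L] [PerfectField L] [Algebra (RatFunc M) L]
        [IsPurelyInseparable (RatFunc M) L]
        (X : Scheme.{0}) (f : X ⟶ Spec (.of L)), IsSeparated f → LocallyOfFiniteType f →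
          QuasiCompact f → IsIntegral X → Scheme.HasResolution X := by
  intro p hp M _ _ _ _ L _ _ _ _ X f hs hl hq hX
  haveI : Fact p.Prime := ⟨hp⟩
  haveI : CharP (RatFunc M) p := inferInstance
  haveI : CharP L p := charP_of_injective_algebraMap (algebraMap (RatFunc M) L).injective p
  haveI : IsReduced X := inferInstance
  exact h p hp L X f hs hl hq inferInstance

end Summit.ResolutionOfSingularities.ResolutionOfSingularities.Theorems.PrimeFieldToPerfect

end
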